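import Mathlib
import Literature.NumberTheory.LFunctions.Zhang2022.Section15U056RateR
import HarnessLib

/-!
# Zhang (2022) §15 p. 88: the u056 → (15.23) → (15.24) chain over the DISCHARGE TARGET OF RECORD
# `Lemma153Rp` for Lemma 15.3 (cell RULING 16e)

Topic `Literature/NumberTheory/LFunctions/Zhang2022` (Landau–Siegel audit tree; verdict-neutral).
Y. Zhang, *Discrete mean estimates and the Landau–Siegel zero*, arXiv:2211.02515v1 (2022)
[Zhang2022LandauSiegel] — an unrefereed manuscript under adjudication (cell siegel-zhang, D-0069,
discharge lane, node `Skeleton.Ded1524`, DAG `Z22:(15.24)` ⇐ `Z22:§15.u056`). Third twin of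
`Section15U056Rate` (printed Lemma 15.3 `Lemma153`) and `Section15U056RateR` (uniform repair
`Lemma153R`): here Lemma 15.3 enters in the `D`-dependent-bound reading
`Typed.Section15C.Lemma153Rp` (the continuation `U` of the repaired `𝒰₁ⱼ` satisfies
`‖U(s)‖ ≤ C·exp(2𝓛^{1/10})` on `Re s ≥ 9/10`, plus the value clause `Step15_u053R`), which the cell
records as the reading the Appendix-A sketch can deliver (`Typed.AppendixA2.Lem153_pfR`).

The point proved here: the u056 step consumes the continuation `U` ONLY through its value at
`s = 1`, which `Step15_u053R` pins to `φ(D)²D⁻²·eulerU1 χ + O(α₁)`; with `‖eulerU1 χ‖ ≤ 1`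
(`norm_eulerU1_le_one`: every factor `(1−q⁻²)²/(1−χ(q)q⁻²)` has modulus `≤ 1 − q⁻²`) this gives the
absolute bound `‖U(1)‖ ≤ 1 + |C₃|π`, so NO bound on `U` away from `s = 1` is used and the derived rate
of u056 / (15.23) stays `O(1/𝓛)` (`u056_rate1_of_exists_calU1R`). Corollaries: `u056_rate1_of_partsRp`,
`eq15_23R_of_partsRp` (RULING 16e's "`eq15_23Rp_of_parts`"), and the leaf's display list of record
`ded1524_of_displays_Rp : (15.6) → (15.17) → (15.22) → u050 → Lemma152 → Lemma153RpI → u055R → u035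
→ u058 → u059 → Skeleton.Ded1524 c′` (the landed `ded1524_of_displays_R3` over the uniform `Lemma153R` is the
same list composed with `Section15C.lemma153Rp_of_R`). WHAT THIS IS NOT: a proof of those displays, nor any claim
about Theorems 1–2 of the manuscript or Landau–Siegel zeros.

## References
* Y. Zhang, arXiv:2211.02515v1 (2022), §15 pp. 87–88. [cite: Zhang2022LandauSiegel, §15 p.88]
-/

noncomputable section

open Complex Real ComplexConjugate Filter
open Literature.NumberTheory.LFunctions.Zhang2022.Skeleton
open Literature.NumberTheory.LFunctions.Zhang2022.Typed

namespace Literature.NumberTheory.LFunctions.Zhang2022.Ded1524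

/-- `log D ≥ M` once `D ≥ ⌈e^M⌉`. [folklore] -/
private theorem le_ell_of_ceil_exp_le₅ {M : ℝ} {D : ℕ} (hD : ⌈Real.exp M⌉₊ ≤ D) : M ≤ ell D := by
  have h : Real.exp M ≤ D := le_trans (Nat.le_ceil _) (by exact_mod_cast hD)
  exact (Real.le_log_iff_exp_le (lt_of_lt_of_le (Real.exp_pos _) h)).mpr h

/-! ## 1. `‖eulerU1 χ‖ ≤ 1` -/

section EulerU1Bound

variable {D : ℕ} (χ : DirichletCharacter ℂ D)

/-- Each factor of `eulerU1` has modulus `≤ 1`: for `q` prime, `|χ(q)| ≤ 1` gives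
`|(1−q⁻²)²/(1−χ(q)q⁻²)| ≤ (1−q⁻²)²/(1−q⁻²) = 1 − q⁻² ≤ 1`.
[cite: Zhang2022LandauSiegel, §15 Lemma 15.3 p.87] -/
private theorem norm_factorU_le_one (p : Nat.Primes) :
    ‖(if Nat.Coprime (p : ℕ) D then
        (1 - 1 / ((p : ℕ) : ℂ) ^ 2) ^ 2 / (1 - χ ((p : ℕ) : ZMod D) / ((p : ℕ) : ℂ) ^ 2) else 1)‖ ≤
      1 := by
  split_ifs with hcop
  · have hp2 : (2 : ℝ) ≤ ((p : ℕ) : ℝ) := by exact_mod_cast p.prop.two_le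
    set r : ℝ := 1 / ((p : ℕ) : ℝ) ^ 2 with hr
    have hr1 : r ≤ 1 / 4 := by
      have h4 : (4 : ℝ) ≤ ((p : ℕ) : ℝ) ^ 2 := by nlinarith
      rw [hr]; exact one_div_le_one_div_of_le (by norm_num) h4
    have hr0 : 0 < r := by rw [hr]; positivity
    have hnum : ‖(1 : ℂ) - 1 / ((p : ℕ) : ℂ) ^ 2‖ = 1 - r := by
      have h1 : (1 : ℂ) - 1 / ((p : ℕ) : ℂ) ^ 2 = ((1 - r : ℝ) : ℂ) := by rw [hr]; push_cast; ring
      rw [h1, Complex.norm_real, Real.norm_of_nonneg (by linarith)]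
    have hden : 1 - r ≤ ‖(1 : ℂ) - χ ((p : ℕ) : ZMod D) / ((p : ℕ) : ℂ) ^ 2‖ := by
      have h1 : ‖χ ((p : ℕ) : ZMod D) / ((p : ℕ) : ℂ) ^ 2‖ ≤ r := by
        rw [norm_div, norm_pow, Complex.norm_natCast, hr]
        exact div_le_div_of_nonneg_right (DirichletCharacter.norm_le_one χ _) (by positivity)
      have h2 := norm_sub_norm_le (1 : ℂ) (χ ((p : ℕ) : ZMod D) / ((p : ℕ) : ℂ) ^ 2)
      rw [norm_one] at h2
      linarith
    have hpos : 0 < ‖(1 : ℂ) - χ ((p : ℕ) : ZMod D) / ((p : ℕ) : ℂ) ^ 2‖ := by linarith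
    rw [norm_div, norm_pow, hnum, div_le_one hpos]
    nlinarith
  · simp

/-- **`‖eulerU1 χ‖ ≤ 1`**: the (convergent, `multipliable_eulerM1_eulerU1`) Euler product
`∏_{(q,D)=1}(1−q⁻²)²/(1−χ(q)q⁻²)` of Lemma 15.3 has every factor of modulus `≤ 1`.
[cite: Zhang2022LandauSiegel, §15 Lemma 15.3 p.87] -/
theorem norm_eulerU1_le_one : ‖Section15C.eulerU1 χ‖ ≤ 1 := by
  obtain ⟨-, hU⟩ := multipliable_eulerM1_eulerU1 χ
  have h := hU.hasProd.norm
  rw [HasProd, SummationFilter.unconditional_filter] at h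
  rw [Section15C.eulerU1]
  exact le_of_tendsto' h fun s =>
    Finset.prod_le_one (fun p _ => norm_nonneg _) fun p _ => norm_factorU_le_one χ p

end EulerU1Bound

/-- `‖φ(D)²/D²‖ ≤ 1` (as a complex number), from `φ(D) ≤ D`. [folklore] -/
private theorem norm_totient_sq_div_sq_le_one (D : ℕ) [NeZero D] :
    ‖(Nat.totient D : ℂ) ^ 2 / (D : ℂ) ^ 2‖ ≤ 1 := by
  have hD0 : 0 < (D : ℝ) := by exact_mod_cast Nat.pos_of_ne_zero (NeZero.ne D)
  have hφ : (Nat.totient D : ℝ) ≤ D := by exact_mod_cast Nat.totient_le D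
  rw [norm_div, norm_pow, norm_pow, Complex.norm_natCast, Complex.norm_natCast,
    div_le_one (by positivity)]
  exact pow_le_pow_left₀ (Nat.cast_nonneg _) hφ 2

/-- Pointwise bookkeeping for `‖U(1)‖`: if `‖U₁ − P·e_U‖ ≤ C₃a` with `0 ≤ a ≤ π`, `‖P‖ ≤ 1` and
`‖e_U‖ ≤ 1`, then `‖U₁‖ ≤ 1 + |C₃|π`. [cite: Zhang2022LandauSiegel, §15 Lemma 15.3 p.87] -/
private theorem norm_U1_le {U₁ P eU : ℂ} {C₃ a : ℝ} (h : ‖U₁ - P * eU‖ ≤ C₃ * a) (ha0 : 0 ≤ a)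
    (haπ : a ≤ π) (hP : ‖P‖ ≤ 1) (heU : ‖eU‖ ≤ 1) : ‖U₁‖ ≤ 1 + |C₃| * π := by
  have h1 : ‖P * eU‖ ≤ 1 := by
    rw [norm_mul]
    calc ‖P‖ * ‖eU‖ ≤ 1 * 1 := mul_le_mul hP heU (norm_nonneg _) zero_le_one
      _ = 1 := one_mul _
  have h2 : C₃ * a ≤ |C₃| * π :=
    (mul_le_mul_of_nonneg_right (le_abs_self C₃) ha0).trans
      (mul_le_mul_of_nonneg_left haπ (abs_nonneg _))
  calc ‖U₁‖ = ‖(U₁ - P * eU) + P * eU‖ := by rw [sub_add_cancel]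
    _ ≤ ‖U₁ - P * eU‖ + ‖P * eU‖ := norm_add_le _ _
    _ ≤ |C₃| * π + 1 := add_le_add (h.trans h2) h1
    _ = 1 + |C₃| * π := by ring

/-! ## 2. u056 at the rate `O(1/𝓛)` from the mere EXISTENCE of the continuation `U` -/

set_option maxHeartbeats 400000 in
/-- **u056 at the rate `O(1/𝓛)` using Lemma 15.3 only through the existence of the continuation `U`
of the repaired `𝒰₁ⱼ` and its value at `1`** (`Step15_u053R`), with (15.22)'s companions u050,
Lemma 15.2, u055R, u035: same conclusion and proof as `u056_rate1_of_partsR`, except that the bound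
for `‖U(1)‖` is taken from `Step15_u053R` and `‖eulerU1 χ‖ ≤ 1` (`‖U(1)‖ ≤ 1 + C₃α₁ ≤ 1 + |C₃|π`), so
no bound on `U` away from `s = 1` is used. Original display (§15 p.88, tex L4363–L4365):
`𝓜₁(1,1;1−βⱼ)·Σ_{n∈𝒩(𝒬),n<T} χ(n)τ₂(n)ϖ₁ⱼ(n)/n = 𝔞φ(D)/D + O(𝓛⁻³)`; derived here with `O(1/𝓛)`.
[cite: Zhang2022LandauSiegel, §15 p.88] -/
theorem u056_rate1_of_exists_calU1R (c' : ℝ)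
    (h50 : Section15C.Step15_u050 c' Section15C.inputs15AB)
    (h152 : Section15C.Lemma152 c' Section15C.inputs15AB)
    (hex : ForAllLarge fun D _ χ => AssumptionA D χ → ∀ j ∈ ({1, 2, 3} : Finset ℕ),
      ∃ U : ℂ → ℂ, Section15C.IsCalU1R c' Section15C.inputs15AB χ j U)
    (h53 : Section15C.Step15_u053R c' Section15C.inputs15AB)
    (h55 : Section15C.Step15_u055R c' Section15C.inputs15AB)
    (h35 : Section15B.Step15_u035 c') :
    ∃ C : ℝ, ForAllLarge fun D _ χ => AssumptionA D χ → ∀ j ∈ ({1, 2, 3} : Finset ℕ),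
      ‖Section15C.inputs15AB.calM1 c' χ 1 1 (1 - betaJ c' D j) *
          Section15C.sumInN c' Section15C.inputs15AB χ j -
        (frakA χ : ℂ) * (Nat.totient D : ℂ) / (D : ℂ)‖ ≤ C / ell D := by
  obtain ⟨C₅, h50⟩ := h50
  obtain ⟨C₁, h152⟩ := h152
  have h153a := hex
  obtain ⟨C₃, h153b⟩ := h53
  obtain ⟨C₄, h55⟩ := h55
  obtain ⟨c₆, C₆, h35⟩ := h35
  -- the absolute bound for `‖U(1)‖` that replaces Lemma 15.3's sup bound
  set C₂ : ℝ := 1 + |C₃| * π with hC₂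
  have hC₂0 : 0 ≤ C₂ := by rw [hC₂]; positivity
  -- threshold: `𝓛 ≥ 3` and `𝓛 ≥ 14|c'|π + 1` (so that `|θ| ≤ 1/14`)
  set M : ℝ := max 3 (14 * |c'| * π + 1) with hM
  have hT : ForAllLarge fun D _ _ => M ≤ ell D :=
    ForAllLarge.of_le ⌈Real.exp M⌉₊ fun D _ _ hD _ _ => le_ell_of_ceil_exp_le₅ hD
  set K : ℝ := |C₆| * |C₅| + |C₆| * |C₄| * π +
    (4 * Real.exp (9 / 2)) ^ 2 * π * (|C₆| * |C₃| + |C₁| * (C₂ + |C₃| * π)) with hK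
  obtain ⟨D₀, h⟩ := (((((h50.and h152).and h153a).and h153b).and h55).and h35).and hT
  refine ⟨K, D₀, fun D _ χ hD hq hp hA j hj => ?_⟩
  obtain ⟨⟨⟨⟨⟨⟨g50, g152⟩, g153a⟩, g153b⟩, g55⟩, g35⟩, hMℓ⟩ := h D χ hD hq hp
  have hℓ3 : 3 ≤ ell D := (le_max_left _ _).trans hMℓ
  have hℓc : 14 * |c'| * π + 1 ≤ ell D := (le_max_right _ _).trans hMℓ
  have hℓ1 : 1 ≤ ell D := by linarith
  have hℓ0 : 0 < ell D := by linarith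
  have hD3 : 3 ≤ D := by
    by_contra hlt
    have : (D : ℝ) < 3 := by exact_mod_cast not_le.mp hlt
    have hD0 : 0 < (D : ℝ) := by exact_mod_cast Nat.pos_of_ne_zero (NeZero.ne D)
    have : ell D < 3 := by
      calc ell D = Real.log D := rfl
        _ < Real.log (Real.exp 3) := Real.log_lt_log hD0 (by
            have := Real.add_one_le_exp (3:ℝ); linarith)
        _ = 3 := Real.log_exp 3
    linarith
  -- `α`, `θ`
  have hα : alpha D = π / ell D ^ 9 := by rw [alpha, bigP, Real.log_exp]
  have hαpos : 0 < alpha D := by rw [hα]; positivity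
  have hα1 : alpha D * ell D = π / ell D ^ 8 := by rw [hα]; field_simp
  have hαℓle : alpha D * ell D ≤ π := by
    rw [hα1]; exact div_le_self Real.pi_pos.le (one_le_pow₀ hℓ1)
  have hθ : |c' * alpha D * ell D| ≤ 1 / 14 := by
    rw [abs_mul, abs_mul, abs_of_pos hαpos, abs_of_pos hℓ0, mul_assoc, hα1,
      show |c'| * (π / ell D ^ 8) = |c'| * π / ell D ^ 8 by ring,
      div_le_div_iff₀ (by positivity) (by norm_num)]
    have h8 : ell D ≤ ell D ^ 8 := by
      calc ell D = ell D ^ 1 := (pow_one _).symm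
        _ ≤ ell D ^ 8 := pow_le_pow_right₀ hℓ1 (by norm_num)
    nlinarith [abs_nonneg c', Real.pi_pos]
  obtain ⟨hβ5, hβre⟩ := betaJ_norm_lt c' hαpos hθ hj
  -- the inputs at `(D, χ, j)`
  set s : ℂ := 1 - betaJ c' D j with hs
  have hs1 : ‖s - 1‖ < 5 * alpha D := by rw [hs, sub_sub_cancel_left, norm_neg]; exact hβ5
  have hsre : 9 / 10 < s.re := by rw [hs, Complex.sub_re, Complex.one_re, hβre]; norm_num
  have e152 : ‖Section15C.inputs15AB.calM1 c' χ 1 1 s - Section15C.eulerM1 χ‖ ≤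
      C₁ * (alpha D * ell D) := g152 hA s hs1
  obtain ⟨U, hU⟩ := g153a hA j hj
  have e153b : ‖U 1 - (Nat.totient D : ℂ) ^ 2 / (D : ℂ) ^ 2 * Section15C.eulerU1 χ‖ ≤
      C₃ * (alpha D * ell D) := g153b hA j hj U hU
  have e55 : ‖Section15C.sumLtT c' Section15C.inputs15AB χ j - deriv χ.LFunction 1 ^ 2 * U 1‖ ≤
      C₄ * (alpha D * ell D) := g55 hA j hj U hU
  have e50 : ‖Section15C.sumNotInN c' Section15C.inputs15AB χ j‖ ≤ C₅ / ell D := g50 hA j hj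
  have e35 : ‖Section15C.inputs15AB.calM1 c' χ 1 1 s‖ ≤ C₆ := by
    have h := g35 hA 1 1 le_rfl le_rfl s hsre
    rw [Section15C.inputs15AB_calM1]
    simpa using h
  -- `‖U(1)‖ ≤ 1 + |C₃|π` from u053R and `‖eulerU1‖ ≤ 1`, `φ(D) ≤ D`
  have hαℓ0' : 0 ≤ alpha D * ell D := mul_nonneg hαpos.le hℓ0.le
  have eU1 : ‖U 1‖ ≤ C₂ := by
    rw [hC₂]
    exact norm_U1_le e153b hαℓ0' hαℓle (norm_totient_sq_div_sq_le_one D) (norm_eulerU1_le_one χ)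
  have hLup : ‖deriv χ.LFunction 1‖ ≤ 4 * Real.exp (9 / 2) * ell D ^ 2 := by
    have h := Lemma31.norm_deriv_LFunction_le_near_one χ (by rw [ell] at hℓ3; exact hℓ3) hp
      (w := 1) (by simp; positivity)
    calc ‖deriv χ.LFunction 1‖ ≤ 2 * Real.exp (9 / 2) * (1 + Real.log D) * Real.log D := h
      _ ≤ 2 * Real.exp (9 / 2) * (ell D + ell D) * ell D := by rw [ell] at hℓ1 ⊢; gcongr
      _ = 4 * Real.exp (9 / 2) * ell D ^ 2 := by ring
  -- the exact main term and the pointwise bookkeeping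
  have hmain := mainTerm_u056 χ hp hq hD3
  have hP := u056_pointwise (ε₁ := |C₁| * (alpha D * ell D)) (ε₃ := |C₃| * (alpha D * ell D))
    (ε₄ := |C₄| * (alpha D * ell D)) (ε₅ := |C₅| / ell D) (C₂ := C₂) (C₆ := |C₆|)
    (e152.trans (by gcongr; exact le_abs_self C₁)) (e153b.trans (by gcongr; exact le_abs_self C₃))
    (e55.trans (by gcongr; exact le_abs_self C₄)) (e50.trans (by gcongr; exact le_abs_self C₅))
    (e35.trans (le_abs_self C₆)) eU1 hLup hmain
  have hIn : Section15C.sumInN c' Section15C.inputs15AB χ j =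
      Section15C.sumLtT c' Section15C.inputs15AB χ j -
        Section15C.sumNotInN c' Section15C.inputs15AB χ j := by
    rw [sumLtT_eq]; ring
  rw [hIn]
  refine hP.trans ?_
  -- collect: everything is `≤ K/𝓛`
  have hαℓ0 : 0 ≤ alpha D * ell D := by positivity
  have t1 : |C₆| * (|C₅| / ell D) = |C₆| * |C₅| * (1 / ell D) := by ring
  have t2 : |C₆| * (|C₄| * (alpha D * ell D)) ≤ |C₆| * |C₄| * π * (1 / ell D) := by
    rw [hα1]
    have : 1 / ell D ^ 8 ≤ 1 / ell D :=
      one_div_le_one_div_of_le hℓ0 (by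
        calc ell D = ell D ^ 1 := (pow_one _).symm
          _ ≤ ell D ^ 8 := pow_le_pow_right₀ hℓ1 (by norm_num))
    calc |C₆| * (|C₄| * (π / ell D ^ 8)) = |C₆| * |C₄| * π * (1 / ell D ^ 8) := by ring
      _ ≤ |C₆| * |C₄| * π * (1 / ell D) := by gcongr
  have t3 : (4 * Real.exp (9 / 2) * ell D ^ 2) ^ 2 *
      (|C₆| * (|C₃| * (alpha D * ell D)) + |C₁| * (alpha D * ell D) * (C₂ + |C₃| * (alpha D * ell D)))
      ≤ (4 * Real.exp (9 / 2)) ^ 2 * π * (|C₆| * |C₃| + |C₁| * (C₂ + |C₃| * π)) * (1 / ell D) := by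
    have h4 : ell D ^ 4 * (alpha D * ell D) = π * (1 / ell D ^ 4) := by rw [hα1]; field_simp
    have i4 : 1 / ell D ^ 4 ≤ 1 / ell D :=
      one_div_le_one_div_of_le hℓ0 (by
        calc ell D = ell D ^ 1 := (pow_one _).symm
          _ ≤ ell D ^ 4 := pow_le_pow_right₀ hℓ1 (by norm_num))
    have inner : |C₆| * (|C₃| * (alpha D * ell D)) + |C₁| * (alpha D * ell D) *
        (C₂ + |C₃| * (alpha D * ell D)) ≤
        (|C₆| * |C₃| + |C₁| * (C₂ + |C₃| * π)) * (alpha D * ell D) := by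
      have : |C₁| * (alpha D * ell D) * (|C₃| * (alpha D * ell D)) ≤
          |C₁| * (alpha D * ell D) * (|C₃| * π) := by gcongr
      nlinarith [abs_nonneg C₆, abs_nonneg C₃, abs_nonneg C₁, hC₂0]
    calc (4 * Real.exp (9 / 2) * ell D ^ 2) ^ 2 * (|C₆| * (|C₃| * (alpha D * ell D)) +
          |C₁| * (alpha D * ell D) * (C₂ + |C₃| * (alpha D * ell D)))
        ≤ (4 * Real.exp (9 / 2) * ell D ^ 2) ^ 2 *
            ((|C₆| * |C₃| + |C₁| * (C₂ + |C₃| * π)) * (alpha D * ell D)) := by gcongr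
      _ = (4 * Real.exp (9 / 2)) ^ 2 * (|C₆| * |C₃| + |C₁| * (C₂ + |C₃| * π)) *
            (ell D ^ 4 * (alpha D * ell D)) := by ring
      _ = (4 * Real.exp (9 / 2)) ^ 2 * (|C₆| * |C₃| + |C₁| * (C₂ + |C₃| * π)) *
            (π * (1 / ell D ^ 4)) := by rw [h4]
      _ = (4 * Real.exp (9 / 2)) ^ 2 * π * (|C₆| * |C₃| + |C₁| * (C₂ + |C₃| * π)) *
            (1 / ell D ^ 4) := by ring
      _ ≤ (4 * Real.exp (9 / 2)) ^ 2 * π * (|C₆| * |C₃| + |C₁| * (C₂ + |C₃| * π)) *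
            (1 / ell D) := by gcongr
  have hKd : K / ell D = K * (1 / ell D) := div_eq_mul_one_div _ _
  rw [hKd, hK]
  linarith


/-! ## 3. The RULING-16e twins over `Lemma153Rp` -/

/-- **u056 at the rate `O(1/𝓛)` over the DISCHARGE TARGET OF RECORD `Lemma153Rp`** (cell RULING
16e; Lemma 15.3 with the `D`-dependent bound `‖U(s)‖ ≤ C·exp(2𝓛^{1/10})` on `Re s ≥ 9/10` — unused —
and the value clause `Step15_u053R`; u055 in the repaired form `Step15_u055R`).
[cite: Zhang2022LandauSiegel, §15 p.88] -/
theorem u056_rate1_of_partsRp (c' : ℝ) (h50 : Section15C.Step15_u050 c' Section15C.inputs15AB)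
    (h152 : Section15C.Lemma152 c' Section15C.inputs15AB)
    (h153 : Section15C.Lemma153Rp c' Section15C.inputs15AB)
    (h55 : Section15C.Step15_u055R c' Section15C.inputs15AB)
    (h35 : Section15B.Step15_u035 c') :
    ∃ C : ℝ, ForAllLarge fun D _ χ => AssumptionA D χ → ∀ j ∈ ({1, 2, 3} : Finset ℕ),
      ‖Section15C.inputs15AB.calM1 c' χ 1 1 (1 - betaJ c' D j) *
          Section15C.sumInN c' Section15C.inputs15AB χ j -
        (frakA χ : ℂ) * (Nat.totient D : ℂ) / (D : ℂ)‖ ≤ C / ell D := by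
  obtain ⟨⟨C, D₀, hC⟩, h53⟩ := h153
  refine u056_rate1_of_exists_calU1R c' h50 h152 ⟨D₀, fun D _ χ hD hq hp hA j hj => ?_⟩ h53 h55 h35
  obtain ⟨U, hU, -⟩ := hC D χ hD hq hp hA j hj
  exact ⟨U, hU⟩

/-- (15.23) in its repaired reading `Eq15_23R` (`O(1/𝓛)`) from (15.22), u050, Lemma 15.2, the
DISCHARGE TARGET OF RECORD `Lemma153Rp` for Lemma 15.3, u055R and u035 (cell RULING 16e's
"`eq15_23Rp_of_parts`"). [cite: Zhang2022LandauSiegel, §15 (15.23) p.88] -/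
theorem eq15_23R_of_partsRp (c' : ℝ) (h22 : Section15C.Eq15_22 c' Section15C.inputs15AB)
    (h50 : Section15C.Step15_u050 c' Section15C.inputs15AB)
    (h152 : Section15C.Lemma152 c' Section15C.inputs15AB)
    (h153 : Section15C.Lemma153Rp c' Section15C.inputs15AB)
    (h55 : Section15C.Step15_u055R c' Section15C.inputs15AB)
    (h35 : Section15B.Step15_u035 c') : Section15C.Eq15_23R c' Section15C.inputs15AB :=
  eq15_23R_of_eq15_22_rate1 c' _ h22 (u056_rate1_of_partsRp c' h50 h152 h153 h55 h35)

/-- **(15.24) / `Skeleton.Ded1524 c′` — the leaf's display list of record over the DISCHARGEABLE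
readings** (cell RULING 16e): (15.6), (15.17), (15.22), u050, Lemma 15.2, `Lemma153Rp` (= the abbrev
`Lemma153RpI c′`, the conclusion of `Typed.AppendixA2.Lem153_pfR`), u055R, u035, u058, u059.
[cite: Zhang2022LandauSiegel, §15 (15.24) p.88] -/
theorem ded1524_of_displays_Rp (c' : ℝ) (h6 : Section15A.Eq15_6 c' Section15A.bLit)
    (h17 : Section15B.Eq15_17 c' Section15A.bLit)
    (h22 : Section15C.Eq15_22 c' Section15C.inputs15AB)
    (h50 : Section15C.Step15_u050 c' Section15C.inputs15AB)
    (h152 : Section15C.Lemma152 c' Section15C.inputs15AB)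
    (h153 : Section15C.Lemma153RpI c')
    (h55 : Section15C.Step15_u055R c' Section15C.inputs15AB)
    (h35 : Section15B.Step15_u035 c')
    (h58 : Section15C.Step15_u058 c' Section15C.inputs15AB)
    (h59 : Section15C.Step15_u059 c' Section15C.inputs15AB) : Ded1524 c' :=
  fun _ _ _ _ => eval1524_of_rates_R
    (Φp := fun D _ χ p => Section15A.Phi1pOf c' χ (Section15A.bLit D χ) p)
    (S := fun D _ χ j => Section15B.calS1 c' χ (Section15A.bLit D χ) j)
    (R := fun _ _ χ j => Section15B.calR1 c' χ j)
    (Rs := fun _ _ χ => Section15A.calR1star c' χ)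
    h6 h17 (eq15_23R_of_partsRp c' h22 h50 h152 h153 h55 h35) (prod_rate5_of_values c' h58 h59)

end Literature.NumberTheory.LFunctions.Zhang2022.Ded1524
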